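import Summits.Langlands.Langlands.Theses.RamifiedCoefficientSeed
import Literature.NumberTheory.GaloisRepresentations.StableLatticeValuationRing
import Literature.NumberTheory.GaloisRepresentations.ResidualGaloisRepOpenKernel
import Literature.NumberTheory.GaloisRepresentations.ResidualRepRestrict
import Literature.NumberTheory.GaloisRepresentations.AbsolutelyIrreducibleReduction
import Literature.NumberTheory.GaloisRepresentations.CarayolSerreLemmasProofs
import Literature.RepresentationTheory.Semisimple.BurnsideMatrixSpan
import HarnessLib

/-!
# Stub A `stub_residualDualReduction` (line `birth`, crux `AdjointSeedFromDuality`,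
# stmt-Langlands-16780)

Reduction bookkeeping for `ρ : Γ_ℚ → GL₃(ℚ̄_p)` residually essentially self-dual in trace form
(`‖tr ρ(σ) − ν(σ) tr ρ(σ⁻¹)‖ < 1`) with `ρ|Γ_{ℚ(ζ_p)}` residually absolutely irreducible:

1. an integral model `ρ₀ = P⁻¹ ρ P : Γ_ℚ → GL₃(ℤ̄_p)` over the open valuation ring `ℤ̄_p` (`Γ_ℚ` is
   compact, `exists_integralModel_of_valuationSubring`) gives the reduction
   `ρ̄ := ρ₀ mod 𝔪 : Γ_ℚ → GL₃(ℤ̄_p/𝔪)` (`IsReductionOf` with `Q = 1`);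
2. `ker ρ̄` is open (`FramedGaloisRep.isOpen_ker_of_isReductionOf`);
3. `ρ̄ ∘ res` (`res : Γ_{ℚ(ζ_p)} → Γ_ℚ`) and the given absolutely irreducible reduction `τ` of
   `ρ|Γ_{ℚ(ζ_p)}` are two reductions of the same representation, hence have the same characteristic
   polynomials (`HasResidualCharpolys.charpoly_eq`), hence the same traces; Burnside
   (`span_eq_top_iff_forall_isIrreducible`) turns absolute irreducibility of `τ` into
   "`τ(Γ)` spans `M₃`", the trace transfer `CarayolSerre.span_eq_top_of_span_eq_top_of_trace_eq`
   moves spanning to `ρ̄ ∘ res`, a fortiori `ρ̄(Γ_ℚ)` spans `M₃`, and Burnside converts back;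
4. the multiplier: an integral model `ν₀` of the continuous character `ν` (same lemma, rank `1`;
   `det` of a `1 × 1` matrix is its entry and is conjugation invariant) reduces to
   `ν̄ := det (ν₀ mod 𝔪)`, and the element `tr ρ₀(σ) − det ν₀(σ) · tr ρ₀(σ⁻¹)` of `ℤ̄_p` maps to
   `tr ρ(σ) − ν(σ) tr ρ(σ⁻¹)` in `ℚ̄_p` (traces and determinants are conjugation invariant), which
   has norm `< 1`, so it lies in `𝔪` and its residue — `tr ρ̄(σ) − ν̄(σ) tr ρ̄(σ⁻¹)` — vanishes.
-/

set_option linter.dupNamespace false -- `Summit.Langlands.Langlands` is the mandated namespace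

namespace Summit.Langlands.Langlands.Cruxes.AdjointSeedFromDuality.Birth

open scoped MatrixGroups
open Literature.NumberTheory.GaloisRepresentations
open IsLocalRing

section Helpers

variable {F : Type*} [Field F] {O : ValuationSubring F} {n : ℕ} {G : Type*} [Group G]
  {k : Type*} [Field k]

/-- The trace of a reduction is the reduction of the trace. -/
private theorem trace_integralReduction (ι : ResidueField O →+* k) (ρ₀ : G →* GL (Fin n) O)
    (g : G) :
    ((integralReduction ι ρ₀ g : GL (Fin n) k) : Matrix (Fin n) (Fin n) k).trace =
      ι (residue O ((ρ₀ g : GL (Fin n) O) : Matrix (Fin n) (Fin n) O).trace) := by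
  rw [← RingHom.comp_apply, AddMonoidHom.map_trace]
  rfl

/-- The determinant of a reduction is the reduction of the determinant. -/
private theorem det_integralReduction (ι : ResidueField O →+* k) (ρ₀ : G →* GL (Fin n) O)
    (g : G) :
    ((integralReduction ι ρ₀ g : GL (Fin n) k) : Matrix (Fin n) (Fin n) k).det =
      ι (residue O ((ρ₀ g : GL (Fin n) O) : Matrix (Fin n) (Fin n) O).det) := by
  rw [← RingHom.comp_apply, RingHom.map_det]
  rfl

/-- The trace of an integral model `B = P⁻¹ A P` is the trace of `A` (conjugation invariance). -/
private theorem coe_trace_eq_of_map_eq {A P : GL (Fin n) F} {B : GL (Fin n) O}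
    (h : Matrix.GeneralLinearGroup.map O.subtype B = P⁻¹ * A * P) :
    ((((B : GL (Fin n) O) : Matrix (Fin n) (Fin n) O).trace : O) : F) =
      ((A : GL (Fin n) F) : Matrix (Fin n) (Fin n) F).trace := by
  calc ((((B : GL (Fin n) O) : Matrix (Fin n) (Fin n) O).trace : O) : F)
      = O.subtype ((B : GL (Fin n) O) : Matrix (Fin n) (Fin n) O).trace := rfl
    _ = ((Matrix.GeneralLinearGroup.map O.subtype B : GL (Fin n) F) :
          Matrix (Fin n) (Fin n) F).trace := AddMonoidHom.map_trace O.subtype _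
    _ = ((A : GL (Fin n) F) : Matrix (Fin n) (Fin n) F).trace := by
        rw [h, Units.val_mul, Units.val_mul, Matrix.trace_units_conj']

/-- The determinant of an integral model `B = P⁻¹ A P` is the determinant of `A`. -/
private theorem coe_det_eq_of_map_eq {A P : GL (Fin n) F} {B : GL (Fin n) O}
    (h : Matrix.GeneralLinearGroup.map O.subtype B = P⁻¹ * A * P) :
    ((((B : GL (Fin n) O) : Matrix (Fin n) (Fin n) O).det : O) : F) =
      ((A : GL (Fin n) F) : Matrix (Fin n) (Fin n) F).det := by
  calc ((((B : GL (Fin n) O) : Matrix (Fin n) (Fin n) O).det : O) : F)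
      = O.subtype ((B : GL (Fin n) O) : Matrix (Fin n) (Fin n) O).det := rfl
    _ = ((Matrix.GeneralLinearGroup.map O.subtype B : GL (Fin n) F) :
          Matrix (Fin n) (Fin n) F).det := RingHom.map_det O.subtype _
    _ = ((A : GL (Fin n) F) : Matrix (Fin n) (Fin n) F).det := by
        rw [h, Units.val_mul, Units.val_mul, Matrix.det_units_conj']

/-- **Absolute irreducibility is detected by traces** (`n ≥ 1`): if `τ : H → GL_n(k)` is absolutely
irreducible and `σ ∘ φ` has the traces of `τ` for some `φ : H → G`, then `σ : G → GL_n(k)` is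
absolutely irreducible — Burnside (`span_eq_top_iff_forall_isIrreducible`) makes `τ(H)` span
`M_n(k)`, the trace transfer (`CarayolSerre.span_eq_top_of_span_eq_top_of_trace_eq`) makes
`σ(φ(H)) ⊆ σ(G)` span, and Burnside converts back. -/
private theorem isAbsIrreducible_of_trace_comp_eq (hn : 0 < n) {k : Type} [Field k] {H : Type*}
    [Group H] {τ : H →* GL (Fin n) k} (hτ : IsAbsIrreducible τ) (σ : G →* GL (Fin n) k)
    (φ : H →* G) (htr : ∀ h, ((σ.comp φ h : GL (Fin n) k) : Matrix (Fin n) (Fin n) k).trace =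
      ((τ h : GL (Fin n) k) : Matrix (Fin n) (Fin n) k).trace) :
    IsAbsIrreducible σ := by
  have hspanτ : Submodule.span k
      (Set.range fun h => ((τ h : GL (Fin n) k) : Matrix (Fin n) (Fin n) k)) = ⊤ :=
    (Literature.RepresentationTheory.Semisimple.span_eq_top_iff_forall_isIrreducible hn τ).2
      fun L _ f => hτ L f
  have hspan' := CarayolSerre.span_eq_top_of_span_eq_top_of_trace_eq τ (σ.comp φ) htr hspanτ
  have hspan : Submodule.span k
      (Set.range fun g => ((σ g : GL (Fin n) k) : Matrix (Fin n) (Fin n) k)) = ⊤ := by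
    rw [← top_le_iff, ← hspan']
    refine Submodule.span_mono ?_
    rintro _ ⟨h, rfl⟩
    exact ⟨φ h, rfl⟩
  intro L _ f
  exact (Literature.RepresentationTheory.Semisimple.span_eq_top_iff_forall_isIrreducible hn σ).1
    hspan L f

end Helpers

/-- **STUB A — reduction bookkeeping.**  For `ρ : Γ_ℚ → GL₃(ℚ̄_p)` residually essentially
self-dual in trace form and with `ρ|Γ_{ℚ(ζ_p)}` residually absolutely irreducible: a reduction
`ρ̄ : Γ_ℚ → GL₃(ℤ̄_p/𝔪)` of `ρ` (integral model over the open valuation ring `ℤ̄_p`, compact `Γ_ℚ`)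
with open kernel, absolutely irreducible already on `Γ_ℚ` (the given abs-irreducible reduction of
`ρ|Γ_{ℚ(ζ_p)}` and `ρ̄ ∘ res` are reductions of the same representation, hence have the same
characteristic polynomials, so `ρ̄ ∘ res` — a fortiori `ρ̄` — is absolutely irreducible), and the
residual multiplier `ν̄` (reduction of an integral model of `ν`) with the trace duality
`tr ρ̄(σ) = ν̄(σ) · tr ρ̄(σ⁻¹)` (reduction of `‖tr ρ(σ) − ν(σ) tr ρ(σ⁻¹)‖ < 1`). -/
theorem stub_residualDualReduction (p : ℕ) [Fact p.Prime]
    (ρ : FramedGaloisRep ℚ (PadicAlgCl p) 3)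
    (hdual : ∃ ν : FramedGaloisRep ℚ (PadicAlgCl p) 1,
      ∀ σ, ‖(ρ σ).val.trace - (ν σ).val 0 0 * (ρ σ⁻¹).val.trace‖ < 1)
    (hirr : (ρ.restrictField (CyclotomicField p ℚ)).IsResiduallyAbsIrreducible) :
    ∃ (ρbar : Field.absoluteGaloisGroup ℚ →* GL (Fin 3) (padicAlgClResidueField p))
      (νbar : Field.absoluteGaloisGroup ℚ →* (padicAlgClResidueField p)ˣ),
      ρ.IsReductionOf (RingHom.id (padicAlgClResidueField p)) ρbar ∧
      IsOpen ((ρbar.ker : Subgroup (Field.absoluteGaloisGroup ℚ)) : Set (Field.absoluteGaloisGroup ℚ)) ∧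
      IsAbsIrreducible ρbar ∧
      ∀ σ, (ρbar σ).val.trace = (νbar σ).val * (ρbar σ⁻¹).val.trace := by
  obtain ⟨ν, hν⟩ := hdual
  have hOopen : IsOpen ((padicAlgClIntegers p : ValuationSubring (PadicAlgCl p)) :
      Set (PadicAlgCl p)) :=
    Valued.isOpen_valuationSubring _
  -- integral models of `ρ` and of the multiplier `ν` over `ℤ̄_p`
  obtain ⟨P, ρ₀, hρ₀⟩ :=
    exists_integralModel_of_valuationSubring (O := padicAlgClIntegers p) hOopen ρ
  obtain ⟨Pν, ν₀, hν₀⟩ :=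
    exists_integralModel_of_valuationSubring (O := padicAlgClIntegers p) hOopen ν
  -- the reduction `ρ̄ = ρ₀ mod 𝔪`
  have hred : ρ.IsReductionOf (RingHom.id (padicAlgClResidueField p))
      (integralReduction (RingHom.id (padicAlgClResidueField p)) ρ₀) :=
    ⟨ρ₀, 1, ⟨P, hρ₀⟩, fun g => by simp⟩
  refine ⟨integralReduction (RingHom.id (padicAlgClResidueField p)) ρ₀,
    Matrix.GeneralLinearGroup.det.comp (integralReduction (RingHom.id (padicAlgClResidueField p)) ν₀),
    hred, FramedGaloisRep.isOpen_ker_of_isReductionOf hred, ?_, fun σ => ?_⟩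
  · -- absolute irreducibility on `Γ_ℚ`, from that of a reduction of `ρ|Γ_{ℚ(ζ_p)}`
    obtain ⟨τ, hτ, hτirr⟩ := hirr
    have hred' := FramedGaloisRep.isReductionOf_restrictField hred (CyclotomicField p ℚ)
    refine isAbsIrreducible_of_trace_comp_eq (by norm_num) hτirr _
      (absGaloisRestrict ℚ (CyclotomicField p ℚ)).toMonoidHom fun g => ?_
    rw [Matrix.trace_eq_neg_charpoly_coeff, Matrix.trace_eq_neg_charpoly_coeff,
      hτ.hasResidualCharpolys.charpoly_eq hred'.hasResidualCharpolys g]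
  · -- the trace duality, reduced modulo `𝔪`
    have hx : ((ρ₀ σ : GL (Fin 3) (padicAlgClIntegers p)) :
          Matrix (Fin 3) (Fin 3) (padicAlgClIntegers p)).trace -
        ((ν₀ σ : GL (Fin 1) (padicAlgClIntegers p)) :
            Matrix (Fin 1) (Fin 1) (padicAlgClIntegers p)).det *
          ((ρ₀ σ⁻¹ : GL (Fin 3) (padicAlgClIntegers p)) :
            Matrix (Fin 3) (Fin 3) (padicAlgClIntegers p)).trace ∈
        maximalIdeal (padicAlgClIntegers p) := by
      rw [mem_maximalIdeal_iff_norm_lt_one (padicAlgCl_mem_valuationSubring_iff p),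
        AddSubgroupClass.coe_sub, MulMemClass.coe_mul, coe_trace_eq_of_map_eq (hρ₀ σ),
        coe_trace_eq_of_map_eq (hρ₀ σ⁻¹), coe_det_eq_of_map_eq (hν₀ σ), Matrix.det_fin_one]
      exact hν σ
    have hres : residue (padicAlgClIntegers p) ((ρ₀ σ : GL (Fin 3) (padicAlgClIntegers p)) :
          Matrix (Fin 3) (Fin 3) (padicAlgClIntegers p)).trace =
        residue (padicAlgClIntegers p) ((ν₀ σ : GL (Fin 1) (padicAlgClIntegers p)) :
            Matrix (Fin 1) (Fin 1) (padicAlgClIntegers p)).det *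
          residue (padicAlgClIntegers p) ((ρ₀ σ⁻¹ : GL (Fin 3) (padicAlgClIntegers p)) :
            Matrix (Fin 3) (Fin 3) (padicAlgClIntegers p)).trace := by
      rw [← map_mul, ← sub_eq_zero, ← map_sub, residue_eq_zero_iff]
      exact hx
    rw [MonoidHom.comp_apply, Matrix.GeneralLinearGroup.val_det_apply, trace_integralReduction,
      trace_integralReduction, det_integralReduction]
    exact hres

end Summit.Langlands.Langlands.Cruxes.AdjointSeedFromDuality.Birth
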